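import Mathlib

/-!
# The three-route bracket: the algebraic core

Paper step (S4-HARDSTEP addenda 35–36, seat p5 g35).  In the three-route blob model
(two marked length-2 routes `a₁–u–v ∋ o`, `a₁–w–v ∋ b` and one free length-2 route
`a₁–z–v`) the cross functional splits as
`crux = (1 − p₃) · TwoRoute + p₃ · B`, where `TwoRoute ≥ 0` is the two-route theorem
and `B = PHI(V₃) − p₁·x·Y₁ − p₂·y·X₂` is the *bracket*: `PHI(V₃)` is the avoidance
crux of the free route, `Y₁ = P(Q, b ∈ K, K avoids V₁, K hits V₃)`, `X₂` symmetric.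

`bracket_nonneg` is the pure algebra of the sign of `B`: writing every mass as its
avoid-`V₃` part plus its hit part (`Z = s + Zh`, `x = u + xh`, `y = w + yh`, `Dv`'s
avoid part `τ`), the hypotheses are
* BHK with avoidance `u·w ≤ s·τ` (kernel: `avoid_crux`'s ingredient),
* the z-coin relations `κ·s ≤ Zh`, `Y₁ ≤ κ·w`, `X₂ ≤ κ·u` (a hit with `v ∉ K` is
  «coin on, both edges of the free route closed», weight `ζ` against `1 − r_z` for the
  avoiding configurations; `κ = ζ / (1 − r_z)`),
* the two-route crux (constant 1) of the hit part, `0 ≤ xh·yh − yh·(p₂·X₂) − xh·(p₁·Y₁)`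
  (the two-route theorem on the graph with `z` merged into `a₂`).
The conclusion is `B ≥ 0`; the proof is `B = FIRST + crux_hit(1)` with
`FIRST ≥ u·w·(1 + κ·(2 − p₁ − p₂)) ≥ 0`.
-/

namespace Summit.Ventures.PercRepro2.CrossAPrimeThreeRoutesAlgebra

/-- The sign of the three-route bracket from BHK-avoid, the z-coin relations and the
two-route crux of the hit part (see the module docstring). -/
theorem bracket_nonneg (s τ u w Zh xh yh Y1 X2 p1 p2 κ : ℝ)
    (hτ : 0 ≤ τ) (hu : 0 ≤ u) (hw : 0 ≤ w) (hp1 : 0 ≤ p1) (hp2 : 0 ≤ p2)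
    (hp12 : p1 + p2 ≤ 2) (hκ : 0 ≤ κ) (hbhk : u * w ≤ s * τ) (hZh : κ * s ≤ Zh)
    (hY1 : Y1 ≤ κ * w) (hX2 : X2 ≤ κ * u)
    (hhit : 0 ≤ xh * yh - yh * (p2 * X2) - xh * (p1 * Y1)) :
    0 ≤ (2 * (s + Zh) * τ - (w + yh) * u - (u + xh) * w + (u + xh) * (w + yh))
      - p1 * (u + xh) * Y1 - p2 * (w + yh) * X2 := by
  have h1 : p1 * u * Y1 ≤ p1 * u * (κ * w) :=
    mul_le_mul_of_nonneg_left hY1 (mul_nonneg hp1 hu)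
  have h2 : p2 * w * X2 ≤ p2 * w * (κ * u) :=
    mul_le_mul_of_nonneg_left hX2 (mul_nonneg hp2 hw)
  have h3 : κ * s * τ ≤ Zh * τ := mul_le_mul_of_nonneg_right hZh hτ
  have h4 : 0 ≤ κ * (s * τ - u * w) := mul_nonneg hκ (sub_nonneg.2 hbhk)
  have h5 : 0 ≤ u * w * (κ * (2 - p1 - p2)) :=
    mul_nonneg (mul_nonneg hu hw) (mul_nonneg hκ (by linarith))
  nlinarith [h1, h2, h3, h4, h5, hhit, hbhk]

/-- The three-route reduction: `crux = (1 − p₃)·TwoRoute + p₃·B` with both parts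
non-negative gives the sign of the cross functional. -/
theorem crux_nonneg_of_bracket (crux T B p3 : ℝ) (h : crux = (1 - p3) * T + p3 * B)
    (hp3 : 0 ≤ p3) (hp3' : p3 ≤ 1) (hT : 0 ≤ T) (hB : 0 ≤ B) : 0 ≤ crux := by
  rw [h]
  have := mul_nonneg (sub_nonneg.2 hp3') hT
  have := mul_nonneg hp3 hB
  linarith

end Summit.Ventures.PercRepro2.CrossAPrimeThreeRoutesAlgebra
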